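import Mathlib
import Summits.PneNP.PneNP.Theorems.SliceTarget.Negative.LoadBearing
import Summits.PneNP.PneNP.Theorems.OneSliceBandImpliesThreshold

/-!
# Route OneSlice, crux `SliceTarget` (stmt-PneNP-2832) — split `SliceTarget ⟸ MonotoneContinuation ∧ SingleThreshold`,
# part I: the slice transport kernel

The canonical TRANSPORT of a function `g` living on the Hamming slice `j` of the edge cube of `K_n` to an
arbitrary edge vector `y`: the average of `g` over the slice-`j` vectors COMPARABLE with `y` (`x ⊆ y` or
`y ⊆ x` as edge sets). This file proves the two structural facts the split's assembly uses:

* `card_nbhd` — the number of slice-`j` vectors comparable with a vector of weight `i` is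
  `D(N,i,j) = C(i,j)` (`j ≤ i`) resp. `C(N-i, j-i)` (`i ≤ j`), and the reciprocity
  `C(N,i)·D(N,i,j) = C(N,j)·D(N,j,i)` (`choose_mul_nbhdCard`);
* `sum_gnpWeight_transport_le` — transporting a nonnegative `g` and integrating against `G(n,p)` gives at
  most the slice average of `g` (the kernel maps `G(n,p)` — indeed every slice law — onto the uniform law of
  slice `j`); whence the `L¹(G(n,p))`-CONTRACTION `l1_transport_le`:
  `‖T g − T h‖_{L¹(G(n,p))} ≤ (1/#slice_j) Σ_{x ∈ slice j} |g x − h x|`.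

Vocabulary: `Edge`, `slice` (ConstantBand lane), `supp` (SliceACZero lane), `gnpWeight` (Literature).
Strategist seat planner-cstrat-stmt-PneNP-2832-r1-0, 2026-08-17.
-/

set_option linter.dupNamespace false -- `Summit.PneNP.PneNP.…`: summit = sub-problem (D-0017)

namespace Summit.PneNP.PneNP.Theorems.SliceTargetSplit

open Literature.Computability.Complexity hiding supp mem_supp
open Finset hiding slice
open Filter hiding mem_sdiff
open Classical
open Summit.PneNP.PneNP.Theorems.ConstantBand.Negative (Edge slice)
open Summit.PneNP.PneNP.Theorems.SliceACZero.Negative (supp mem_supp card_supp supp_injective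
  supp_indicator)

noncomputable section

variable {n : ℕ}

/-! ### Comparability, neighbourhoods, transport -/

/-- Comparability of two edge vectors: one edge set contains the other. [folklore] -/
def Comp (x y : Edge n → Bool) : Prop :=
  (∀ e, x e = true → y e = true) ∨ (∀ e, y e = true → x e = true)

/-- Comparability is symmetric. [folklore] -/
theorem comp_comm {x y : Edge n → Bool} : Comp x y ↔ Comp y x := Or.comm

/-- Comparability through supports. [folklore] -/
theorem comp_iff_supp {x y : Edge n → Bool} : Comp x y ↔ supp x ⊆ supp y ∨ supp y ⊆ supp x := by
  simp only [Comp, Finset.subset_iff, mem_supp]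

/-- The slice-`j` vectors comparable with `y`. [folklore] -/
def nbhd (j : ℕ) (y : Edge n → Bool) : Finset (Edge n → Bool) :=
  (slice n j).filter fun x => Comp x y

/-- Membership in a neighbourhood. [folklore] -/
theorem mem_nbhd {j : ℕ} {y x : Edge n → Bool} : x ∈ nbhd j y ↔ edgeCount x = j ∧ Comp x y := by
  simp only [nbhd, slice, mem_filter, mem_univ, true_and]

/-- **Transport** of a real function on slice `j` to the vector `y`: its average over the slice-`j`
vectors comparable with `y` (junk `0` when there is none). [folklore] -/
def transport (j : ℕ) (g : (Edge n → Bool) → ℝ) (y : Edge n → Bool) : ℝ :=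
  (∑ x ∈ nbhd j y, g x) / #(nbhd j y)

/-- The real indicator of a Boolean function. [folklore] -/
def ind (f : (Edge n → Bool) → Bool) (x : Edge n → Bool) : ℝ := if f x = true then 1 else 0

/-- The `L¹(G(n,p))` distance of two real functions on the edge cube (a finite weighted sum). [folklore] -/
def l1 (n : ℕ) (p : ℝ) (u v : (Edge n → Bool) → ℝ) : ℝ := ∑ y, gnpWeight n p y * |u y - v y|

/-- The neighbourhood size function `D(N,i,j)`. [folklore] -/
def nbhdCard (N i j : ℕ) : ℕ := if j ≤ i then i.choose j else (N - i).choose (j - i)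

/-! ### Indicators and `l1` bookkeeping -/

/-- Indicators are nonnegative. [folklore] -/
theorem ind_nonneg (f : (Edge n → Bool) → Bool) (x : Edge n → Bool) : 0 ≤ ind f x := by
  unfold ind; split_ifs <;> norm_num

/-- Indicators are at most `1`. [folklore] -/
theorem ind_le_one (f : (Edge n → Bool) → Bool) (x : Edge n → Bool) : ind f x ≤ 1 := by
  unfold ind; split_ifs <;> norm_num

/-- `|𝟙[f x] − 𝟙[g x]| = 𝟙[f x ≠ g x]`. [folklore] -/
theorem abs_ind_sub_ind (f g : (Edge n → Bool) → Bool) (x : Edge n → Bool) :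
    |ind f x - ind g x| = if f x ≠ g x then 1 else 0 := by
  unfold ind
  cases f x <;> cases g x <;> simp

/-- The `L¹(G(n,p))` distance is symmetric. [folklore] -/
theorem l1_comm (p : ℝ) (u v : (Edge n → Bool) → ℝ) : l1 n p u v = l1 n p v u := by
  unfold l1; exact sum_congr rfl fun y _ => by rw [abs_sub_comm]

/-- The `L¹(G(n,p))` distance is nonnegative for `0 ≤ p ≤ 1`. [folklore] -/
theorem l1_nonneg {p : ℝ} (hp0 : 0 ≤ p) (hp1 : p ≤ 1) (u v : (Edge n → Bool) → ℝ) : 0 ≤ l1 n p u v :=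
  sum_nonneg fun y _ => mul_nonneg (gnpWeight_nonneg hp0 hp1 y) (abs_nonneg _)

/-- Triangle inequality for `l1`. [folklore] -/
theorem l1_triangle {p : ℝ} (hp0 : 0 ≤ p) (hp1 : p ≤ 1) (u v w : (Edge n → Bool) → ℝ) :
    l1 n p u w ≤ l1 n p u v + l1 n p v w := by
  unfold l1
  rw [← sum_add_distrib]
  refine sum_le_sum fun y _ => ?_
  rw [← mul_add]
  exact mul_le_mul_of_nonneg_left (abs_sub_le _ _ _) (gnpWeight_nonneg hp0 hp1 y)

/-- The `l1` distance of two indicators is the `G(n,p)`-probability of disagreement. [folklore] -/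
theorem l1_ind_ind (p : ℝ) (f g : (Edge n → Bool) → Bool) :
    l1 n p (ind f) (ind g) = gnpProb n p (univ.filter fun x => f x ≠ g x) := by
  unfold l1 gnpProb
  rw [sum_filter]
  refine sum_congr rfl fun y _ => ?_
  rw [abs_ind_sub_ind]
  split_ifs <;> simp

/-- `l1` regrouped by edge count. [folklore] -/
theorem l1_eq_sum_slices (p : ℝ) (u v : (Edge n → Bool) → ℝ) :
    l1 n p u v = ∑ i ∈ range (n.choose 2 + 1),
      p ^ i * (1 - p) ^ (n.choose 2 - i) * ∑ y ∈ slice n i, |u y - v y| := by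
  unfold l1
  rw [← sum_fiberwise_of_maps_to (g := edgeCount) (t := range (n.choose 2 + 1)) (s := univ)]
  · refine sum_congr rfl fun i _ => ?_
    rw [mul_sum]
    refine sum_congr rfl fun y hy => ?_
    rw [gnpWeight, (mem_filter.1 hy).2]
  · intro x _
    rw [mem_range, Nat.lt_succ_iff, edgeCount, ← card_edgeSet_top_fin n, ← card_univ]
    exact card_filter_le _ _

/-! ### Supports and comparability -/

/-- Comparable vectors with the smaller weight on the left are nested on the left. [folklore] -/
theorem supp_subset_of_comp_of_le {x y : Edge n → Bool} (h : Comp x y) (hle : edgeCount x ≤ edgeCount y) :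
    supp x ⊆ supp y := by
  rcases comp_iff_supp.1 h with h | h
  · exact h
  · rw [← card_supp, ← card_supp] at hle
    exact (Finset.eq_of_subset_of_card_le h hle).symm.subset

/-- The indicator vector of an edge set. [folklore] -/
def ofSet (s : Finset (Edge n)) : Edge n → Bool := fun e => decide (e ∈ s)

/-- The support of the indicator vector of `s` is `s`. [folklore] -/
theorem supp_ofSet (s : Finset (Edge n)) : supp (ofSet s) = s := supp_indicator s

/-- A vector is the indicator vector of its support. [folklore] -/
theorem ofSet_supp (x : Edge n → Bool) : ofSet (supp x) = x :=
  supp_injective (supp_ofSet _)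

/-- The indicator vector of `s` has `#s` edges. [folklore] -/
theorem edgeCount_ofSet (s : Finset (Edge n)) : edgeCount (ofSet s) = #s := by
  rw [← card_supp, supp_ofSet]

/-! ### Neighbourhood sizes -/

/-- Downward neighbourhoods: for `j ≤ e(y)`, the slice-`j` vectors comparable with `y` are the `j`-subsets of
its support, `C(e(y), j)` of them. [folklore] -/
theorem card_nbhd_of_le {j : ℕ} {y : Edge n → Bool} (hj : j ≤ edgeCount y) :
    #(nbhd j y) = (edgeCount y).choose j := by
  rw [← card_supp, ← card_powersetCard]
  refine card_nbij' supp ofSet ?_ ?_ ?_ ?_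
  · intro x hx
    rw [mem_coe, mem_nbhd] at hx
    rw [mem_coe, mem_powersetCard]
    refine ⟨supp_subset_of_comp_of_le hx.2 (hx.1 ▸ hj), ?_⟩
    rw [card_supp, hx.1]
  · intro s hs
    rw [mem_coe, mem_powersetCard] at hs
    rw [mem_coe, mem_nbhd]
    refine ⟨by rw [edgeCount_ofSet, hs.2], comp_iff_supp.2 (Or.inl ?_)⟩
    rw [supp_ofSet]; exact hs.1
  · intro x _; exact ofSet_supp x
  · intro s _; exact supp_ofSet s

/-- Upward neighbourhoods: for `e(y) ≤ j`, the slice-`j` vectors comparable with `y` are the supersets of its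
support of size `j`, `C(N - e(y), j - e(y))` of them. [folklore] -/
theorem card_nbhd_of_ge {j : ℕ} {y : Edge n → Bool} (hj : edgeCount y ≤ j) :
    #(nbhd j y) = (n.choose 2 - edgeCount y).choose (j - edgeCount y) := by
  have hc : #(univ \ supp y) = n.choose 2 - edgeCount y := by
    rw [card_sdiff_of_subset (subset_univ _), card_univ, card_edgeSet_top_fin, card_supp]
  rw [← hc, ← card_powersetCard]
  refine card_nbij' (fun x => supp x \ supp y) (fun t => ofSet (supp y ∪ t)) ?_ ?_ ?_ ?_
  · intro x hx
    rw [mem_coe, mem_nbhd] at hx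
    have hyx : supp y ⊆ supp x := supp_subset_of_comp_of_le (comp_comm.1 hx.2) (hx.1 ▸ hj)
    rw [mem_coe, mem_powersetCard]
    refine ⟨sdiff_subset_sdiff (subset_univ _) le_rfl, ?_⟩
    rw [card_sdiff_of_subset hyx, card_supp, card_supp, hx.1]
  · intro t ht
    rw [mem_coe, mem_powersetCard] at ht
    have hdisj : Disjoint (supp y) t := by
      rw [Finset.disjoint_left]
      intro e he het
      have := ht.1 het
      rw [mem_sdiff] at this
      exact this.2 he
    rw [mem_coe, mem_nbhd]
    refine ⟨?_, comp_iff_supp.2 (Or.inr ?_)⟩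
    · rw [edgeCount_ofSet, card_union_of_disjoint hdisj, card_supp, ht.2]
      omega
    · rw [supp_ofSet]; exact subset_union_left
  · intro x hx
    rw [mem_coe, mem_nbhd] at hx
    have hyx : supp y ⊆ supp x := supp_subset_of_comp_of_le (comp_comm.1 hx.2) (hx.1 ▸ hj)
    change ofSet (supp y ∪ (supp x \ supp y)) = x
    rw [union_sdiff_of_subset hyx, ofSet_supp]
  · intro t ht
    rw [mem_coe, mem_powersetCard] at ht
    change supp (ofSet (supp y ∪ t)) \ supp y = t
    rw [supp_ofSet, union_sdiff_left, Finset.sdiff_eq_self_iff_disjoint]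
    rw [Finset.disjoint_left]
    intro e het he
    have := ht.1 het
    rw [mem_sdiff] at this
    exact this.2 he

/-- **Neighbourhood sizes.** A vector of weight `i` has exactly `D(N,i,j)` slice-`j` vectors comparable with
it. [folklore] -/
theorem card_nbhd {i j : ℕ} {y : Edge n → Bool} (hy : edgeCount y = i) : #(nbhd j y) = nbhdCard (n.choose 2) i j := by
  unfold nbhdCard
  split_ifs with h
  · rw [card_nbhd_of_le (hy ▸ h), hy]
  · rw [card_nbhd_of_ge (by rw [hy]; omega), hy]

/-- **Reciprocity** `C(N,i)·D(N,i,j) = C(N,j)·D(N,j,i)` (both count the comparable pairs between the slices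
`i` and `j`). [folklore] -/
theorem choose_mul_nbhdCard (N i j : ℕ) : N.choose i * nbhdCard N i j = N.choose j * nbhdCard N j i := by
  unfold nbhdCard
  rcases le_or_gt j i with hji | hij
  · rw [if_pos hji]
    rcases hji.eq_or_lt with rfl | hlt
    · simp
    · rw [if_neg (not_le.2 hlt)]
      exact Nat.choose_mul (n := N) hji
  · rw [if_neg (not_le.2 hij), if_pos hij.le]
    exact (Nat.choose_mul (n := N) hij.le).symm

/-- Neighbourhoods inside the cube are nonempty: `D(N,i,j) > 0` for `i, j ≤ N`. [folklore] -/
theorem nbhdCard_pos {N i j : ℕ} (hi : i ≤ N) (hj : j ≤ N) : 0 < nbhdCard N i j := by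
  unfold nbhdCard
  split_ifs with h
  · exact Nat.choose_pos h
  · exact Nat.choose_pos (by omega)

/-! ### Double counting and the contraction -/

/-- **Double counting of comparable pairs** between the slices `i` and `j`, with a weight depending on both
ends. [folklore] -/
theorem sum_slice_sum_nbhd (i j : ℕ) (F : (Edge n → Bool) → (Edge n → Bool) → ℝ) :
    ∑ y ∈ slice n i, ∑ x ∈ nbhd j y, F x y = ∑ x ∈ slice n j, ∑ y ∈ nbhd i x, F x y := by
  unfold nbhd
  simp_rw [sum_filter]
  rw [sum_comm]
  refine sum_congr rfl fun x _ => sum_congr rfl fun y _ => ?_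
  simp only [comp_comm]

/-- Summing a function of the slice-`j` end over all comparable pairs: each `x ∈ slice j` is counted
`D(N,j,i)` times. [folklore] -/
theorem sum_slice_sum_nbhd_left (i j : ℕ) (G : (Edge n → Bool) → ℝ) :
    ∑ y ∈ slice n i, ∑ x ∈ nbhd j y, G x = (nbhdCard (n.choose 2) j i : ℝ) * ∑ x ∈ slice n j, G x := by
  rw [sum_slice_sum_nbhd i j (fun x _ => G x), mul_sum]
  refine sum_congr rfl fun x hx => ?_
  rw [sum_const, nsmul_eq_mul, card_nbhd (mem_filter.1 hx).2]

/-- The transport of a nonnegative function is nonnegative. [folklore] -/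
theorem transport_nonneg {j : ℕ} {g : (Edge n → Bool) → ℝ} (hg : ∀ x, 0 ≤ g x) (y : Edge n → Bool) :
    0 ≤ transport j g y :=
  div_nonneg (sum_nonneg fun x _ => hg x) (Nat.cast_nonneg _)

/-- Transport is linear: differences. [folklore] -/
theorem transport_sub (j : ℕ) (g h : (Edge n → Bool) → ℝ) (y : Edge n → Bool) :
    transport j g y - transport j h y = transport j (fun x => g x - h x) y := by
  unfold transport
  rw [sum_sub_distrib, sub_div]

/-- `|T g| ≤ T |g|`. [folklore] -/
theorem abs_transport_le (j : ℕ) (g : (Edge n → Bool) → ℝ) (y : Edge n → Bool) :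
    |transport j g y| ≤ transport j (fun x => |g x|) y := by
  unfold transport
  rw [abs_div, Nat.abs_cast]
  exact div_le_div_of_nonneg_right (abs_sum_le_sum_abs _ _) (Nat.cast_nonneg _)

/-- **The kernel maps `G(n,p)` below the uniform law of slice `j`**: for nonnegative `g`,
`Σ_y w_p(y)·(T g)(y) ≤ (1/#slice_j)·Σ_{x ∈ slice j} g x` (`0 ≤ p ≤ 1`; equality unless `j > C(n,2)`, where
both sides vanish). [folklore] -/
theorem sum_gnpWeight_transport_le {p : ℝ} (hp0 : 0 ≤ p) (hp1 : p ≤ 1) (j : ℕ) {g : (Edge n → Bool) → ℝ}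
    (hg : ∀ x, 0 ≤ g x) :
    ∑ y, gnpWeight n p y * transport j g y ≤ (∑ x ∈ slice n j, g x) / #(slice n j) := by
  set S : ℝ := ∑ x ∈ slice n j, g x with hS
  have hS0 : 0 ≤ S := sum_nonneg fun x _ => hg x
  -- regroup by the weight of `y`
  have hregroup : ∑ y, gnpWeight n p y * transport j g y =
      ∑ i ∈ range ((n.choose 2) + 1), p ^ i * (1 - p) ^ ((n.choose 2) - i) * ∑ y ∈ slice n i, transport j g y := by
    rw [← sum_fiberwise_of_maps_to (g := edgeCount) (t := range ((n.choose 2) + 1)) (s := univ)]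
    · refine sum_congr rfl fun i _ => ?_
      rw [mul_sum]
      refine sum_congr rfl fun y hy => ?_
      rw [gnpWeight, (mem_filter.1 hy).2]
    · intro x _
      rw [mem_range, Nat.lt_succ_iff, edgeCount, ← card_edgeSet_top_fin n, ← card_univ]
      exact card_filter_le _ _
  -- on slice `i` the transport sums to `(D((n.choose 2),j,i)/D((n.choose 2),i,j))·S ≤ (C((n.choose 2),i)/C((n.choose 2),j))·S`
  have hslice : ∀ i ∈ range ((n.choose 2) + 1),
      ∑ y ∈ slice n i, transport j g y ≤ ((n.choose 2).choose i : ℝ) * (S / ((n.choose 2).choose j : ℝ)) := by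
    intro i _
    have hT : ∑ y ∈ slice n i, transport j g y =
        (∑ y ∈ slice n i, ∑ x ∈ nbhd j y, g x) / (nbhdCard (n.choose 2) i j : ℝ) := by
      rw [sum_div]
      refine sum_congr rfl fun y hy => ?_
      rw [transport, card_nbhd (mem_filter.1 hy).2]
    rw [hT, sum_slice_sum_nbhd_left i j g, ← hS]
    have hrec := choose_mul_nbhdCard (n.choose 2) i j
    rcases Nat.eq_zero_or_pos (nbhdCard (n.choose 2) i j) with hD | hD
    · rw [hD, Nat.cast_zero, div_zero]
      exact mul_nonneg (Nat.cast_nonneg _) (div_nonneg hS0 (Nat.cast_nonneg _))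
    rcases Nat.eq_zero_or_pos ((n.choose 2).choose j) with hCj | hCj
    · -- slice `j` is empty: `S = 0`
      have hjN : (n.choose 2) < j := by
        by_contra h; push Not at h; exact absurd hCj (Nat.choose_pos h).ne'
      have hS' : S = 0 := by
        rw [hS]
        refine sum_eq_zero fun x hx => ?_
        exfalso
        have hx' := (mem_filter.1 hx).2
        have : edgeCount x ≤ n.choose 2 := by
          rw [edgeCount, ← card_edgeSet_top_fin n, ← card_univ]; exact card_filter_le _ _
        omega
      rw [hS']; simp
    have hD' : (0 : ℝ) < nbhdCard (n.choose 2) i j := by exact_mod_cast hD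
    have hCj' : (0 : ℝ) < (n.choose 2).choose j := by exact_mod_cast hCj
    have hrec' : ((n.choose 2).choose i : ℝ) * nbhdCard (n.choose 2) i j = (n.choose 2).choose j * nbhdCard (n.choose 2) j i := by exact_mod_cast hrec
    rw [div_le_iff₀ hD']
    calc (nbhdCard (n.choose 2) j i : ℝ) * S = ((n.choose 2).choose j * nbhdCard (n.choose 2) j i) * (S / (n.choose 2).choose j) := by
          field_simp
      _ = ((n.choose 2).choose i : ℝ) * (S / (n.choose 2).choose j) * nbhdCard (n.choose 2) i j := by rw [← hrec']; ring
    exact le_rfl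
  rw [hregroup]
  calc ∑ i ∈ range ((n.choose 2) + 1), p ^ i * (1 - p) ^ ((n.choose 2) - i) * ∑ y ∈ slice n i, transport j g y
      ≤ ∑ i ∈ range ((n.choose 2) + 1), p ^ i * (1 - p) ^ ((n.choose 2) - i) * (((n.choose 2).choose i : ℝ) * (S / ((n.choose 2).choose j : ℝ))) :=
        sum_le_sum fun i hi => mul_le_mul_of_nonneg_left (hslice i hi)
          (mul_nonneg (pow_nonneg hp0 _) (pow_nonneg (sub_nonneg.2 hp1) _))
    _ = (∑ i ∈ range ((n.choose 2) + 1), ((n.choose 2).choose i : ℝ) * p ^ i * (1 - p) ^ ((n.choose 2) - i)) * (S / (n.choose 2).choose j) := by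
        rw [sum_mul]; exact sum_congr rfl fun i _ => by ring
    _ = S / #(slice n j) := by
        rw [binomialWeight_sum_range (b := fun i => ((n.choose 2).choose i : ℝ) * p ^ i * (1 - p) ^ ((n.choose 2) - i))
          (fun i => rfl), one_mul, card_slice]

/-- **The transport kernel is an `L¹(G(n,p))` contraction from the uniform law of slice `j`.** [folklore] -/
theorem l1_transport_le {p : ℝ} (hp0 : 0 ≤ p) (hp1 : p ≤ 1) (j : ℕ) (g h : (Edge n → Bool) → ℝ) :
    l1 n p (transport j g) (transport j h) ≤ (∑ x ∈ slice n j, |g x - h x|) / #(slice n j) := by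
  refine le_trans ?_ (sum_gnpWeight_transport_le hp0 hp1 j (g := fun x => |g x - h x|) fun x => abs_nonneg _)
  unfold l1
  refine sum_le_sum fun y _ => mul_le_mul_of_nonneg_left ?_ (gnpWeight_nonneg hp0 hp1 y)
  rw [transport_sub]
  exact abs_transport_le j _ y

/-- The slice-`j` average distance of two indicators is the counting error fraction. [folklore] -/
theorem sum_slice_abs_ind_sub_ind (j : ℕ) (f g : (Edge n → Bool) → Bool) :
    ∑ x ∈ slice n j, |ind f x - ind g x| = #((slice n j).filter fun x => f x ≠ g x) := by
  rw [← sum_boole]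
  refine sum_congr rfl fun x _ => ?_
  rw [abs_ind_sub_ind]

/-- **Registered form of the contraction** (sub-goal `transportContraction` of stmt-PneNP-18471, the item whose
inline ratio is `transport j (ind C.eval)`): for every `n`, `0 ≤ p ≤ 1`, slice `j` and real `g, h` on the edge cube,
`‖T_j g − T_j h‖_{L¹(G(n,p))} ≤ (1/#slice_j)·Σ_{x ∈ slice j}|g x − h x|`. [folklore] -/
theorem transportContraction : ∀ (n : ℕ) (p : ℝ), 0 ≤ p → p ≤ 1 → ∀ (j : ℕ) (g h : (Edge n → Bool) → ℝ), l1 n p (transport j g) (transport j h) ≤ (∑ x ∈ slice n j, |g x - h x|) / #(slice n j) :=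
  fun _ _ hp0 hp1 j g h => l1_transport_le hp0 hp1 j g h

end

end Summit.PneNP.PneNP.Theorems.SliceTargetSplit
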